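import Summits.NavierStokesRegularity.NavierStokesRegularity.Theses.PalasekTowerBreakdown
import Summits.NavierStokesRegularity.FluidComputer.PalasekTowerHeredityWitnessWindow

/-!
# NavierStokesRegularity — route `PalasekTowerBreakdown`, item `HeredityAtOne`: the WINDOW form by name

Supports `stmt-NavierStokesRegularity-19249` (`HeredityAtOne`, first rung of the split crux
`EpisodeInduction`; it does NOT close it and nobody claims it), with the parent 19178 and the sibling
19250 in the same currency. Cell `ns-blowup`, seat `ns-blowup-ecbridge-6` (g3; D-0074 GROUP C «BRIDGE
SUPPORT»). LABEL: E–C typing (pure glue, by name on the route decls, over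
`FluidComputer/PalasekTowerHeredityWitnessWindow.lean`, p433214). WHAT THIS IS NOT: not NS — no stage,
flow, tower or blow-up is constructed or asserted; the items are OPEN and appear only inside
equivalences / as conclusions of implications whose hypotheses nobody has discharged.

The heredity-witness lineage typed the certificate of one tower level in DATUM form (p417894/p423427:
the design's flow re-certified from `t = 0`, `HeredityAtOne ↔ HeredityWitness 1` with no hypothesis).
p433214 shows that ONE WINDOW RUN suffices: a classical solution of the design's system on
`[τ k - ε, τ (k+1)]` restarted from the registered stage's OWN state at any time `τ k - ε` inside
its slab (`0 < ε ≤ τ k`), with finite energy there, below `c₂ Y_{k+1}` on `[τ k, τ (k+1)]` and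
meeting the three level-`k+1` floors at `τ (k+1)`, EXTENDS the stage — W14-free uniqueness on the
overlap (the stage is the bounded competitor by its own ceiling), pressure re-gauge by Seeley,
open-overlap gluing; no named fact, no closed-junction jet matching. Here, by name:

* `palasekTowerBreakdown_heredityAtOne_iff_window_solutions : PalasekTowerBreakdown.HeredityAtOne ↔`
  «every registered level-1 stage of every pinned (Λ = 8, θ = 6/5) rigid quiet wide design admits
  one window run on `[τ₁ - ε, τ₂]` from its own state, finite energy, below `(5/3) Y₂ ≈ 1.02·10⁴`
  on `[τ₁, τ₂]`, with at `τ₂` speed `≥ Y₂ ≈ 6140`, gradient `≥ A₂ ≈ 5.04·10⁶` and an `N₂`-core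
  loop (radius `1/N₂ ≈ 1.22·10⁻³`, circulation `≥ N₂^{3/10} ≈ 7.48`) in the ball» — numbers
  certified in `FluidComputer/PalasekTowerHeredityWitnessCalibration.lean` (p432248);
* `palasekTowerBreakdown_heredityAtOne_of_window_solutions` (the entry a prover or a certificate
  would use), `palasekTowerBreakdown_heredityFromTwo_iff_window_solutions` (item 19250: the same at
  every `k ≥ 2`), `palasekTowerBreakdown_episodeInduction_iff_window_solutions` (item 19178: every
  `k ≥ 1`).

References: S. Palasek, arXiv:2605.13827 §4 [cite: Palasek2026ElementaryModel, §4]; H. Sohr, *The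
Navier–Stokes Equations*, Birkhäuser 2001, Ch. V Thm. 1.5.1 [cite: Sohr2001, Ch. V Thm. 1.5.1].
-/

-- `Summit.<Summit>.<Problem>` is the tree's mandated summit-side namespace (CONVENTIONS §2); for this
-- single-conjunct summit the two coincide, so the duplicate is deliberate.
set_option linter.dupNamespace false

namespace Summit.NavierStokesRegularity.NavierStokesRegularity.Theorems

open Set MeasureTheory
open scoped ENNReal ContDiff
open Literature.Analysis.FluidPDE
open Summit.NavierStokesRegularity.NavierStokesRegularity.Theses
open Summit.NavierStokesRegularity.FluidComputer.PalasekTowerClayBridge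

/-- **Item `HeredityAtOne` in WINDOW form — no hypothesis**: the route decl holds iff every globally
anchored registered level-`1` stage `s` of every pinned rigid quiet wide design admits, for some
`0 < ε ≤ τ₁`, a classical solution of the design's system on `[τ₁ - ε, τ₂]` from the stage's own
state `s.u (τ₁ - ε)`, with finite energy, below `c₂ Y₂` on `[τ₁, τ₂]`, meeting the three level-`2`
floors at `τ₂` (body `heredityAtOne_iff_window_solutions`, p433214). [cite: Sohr2001, Ch. V Thm. 1.5.1] -/
theorem palasekTowerBreakdown_heredityAtOne_iff_window_solutions :
    PalasekTowerBreakdown.HeredityAtOne ↔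
      ∀ S : Schedule TowerRates.wide, S.Pins 8 (6 / 5) → S.Rigid → S.Quiet →
        ∀ s : Stage 1 TowerRates.wide S (Margins.routeG TowerRates.wide) 1,
          ∃ ε : ℝ, 0 < ε ∧ ε ≤ S.τ 1 ∧
          ∃ (v : ℝ → EuclideanSpace ℝ (Fin 3) → EuclideanSpace ℝ (Fin 3))
            (q : ℝ → EuclideanSpace ℝ (Fin 3) → ℝ),
            IsClassicalNSSolutionOn (Icc (S.τ 1 - ε) (S.τ 2)) 1 S.f v q ∧
            v (S.τ 1 - ε) = s.u (S.τ 1 - ε) ∧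
            (∃ C : ℝ≥0∞, C < ⊤ ∧ ∀ t ∈ Icc (S.τ 1 - ε) (S.τ 2), ∫⁻ x, ‖v t x‖ₑ ^ 2 ≤ C) ∧
            (∀ t ∈ Icc (S.τ 1) (S.τ 2), ∀ x, ‖v t x‖ ≤ S.c₂ * TowerRates.wide.Y 2) ∧
            (∃ x, ‖x‖ ≤ S.radius ∧ S.c₁ * TowerRates.wide.Y 2 ≤ ‖v (S.τ 2) x‖) ∧
            (∃ x, ‖x‖ ≤ S.radius ∧
              S.c₁ * TowerRates.wide.A 2 ≤ ‖fderiv ℝ (v (S.τ 2)) x‖) ∧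
            (∃ (x : EuclideanSpace ℝ (Fin 3)) (γ : ℝ → EuclideanSpace ℝ (Fin 3)),
              ‖x‖ ≤ S.radius ∧ ContDiff ℝ 1 γ ∧ γ 0 = γ 1 ∧
              (∀ σ ∈ Icc (0 : ℝ) 1, γ σ ∈ Metric.closedBall x (1 / TowerRates.wide.N 2)) ∧
              (∀ σ ∈ Icc (0 : ℝ) 1, ‖deriv γ σ‖ ≤ 8 * Real.pi / TowerRates.wide.N 2) ∧
              S.c₁ * TowerRates.wide.N 2 ^ (TowerRates.wide.β - 2) ≤
                circulation (v (S.τ 2)) γ) := by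
  unfold PalasekTowerBreakdown.HeredityAtOne
  exact heredityAtOne_iff_window_solutions

/-- **The window-run entry for item 19249**: one window run per registered level-`1` stage, from its
own state, with the ceiling and the level-`2` floors ⇒ `PalasekTowerBreakdown.HeredityAtOne`.
[cite: Sohr2001, Ch. V Thm. 1.5.1] -/
theorem palasekTowerBreakdown_heredityAtOne_of_window_solutions
    (h : ∀ S : Schedule TowerRates.wide, S.Pins 8 (6 / 5) → S.Rigid → S.Quiet →
        ∀ s : Stage 1 TowerRates.wide S (Margins.routeG TowerRates.wide) 1,
          ∃ ε : ℝ, 0 < ε ∧ ε ≤ S.τ 1 ∧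
          ∃ (v : ℝ → EuclideanSpace ℝ (Fin 3) → EuclideanSpace ℝ (Fin 3))
            (q : ℝ → EuclideanSpace ℝ (Fin 3) → ℝ),
            IsClassicalNSSolutionOn (Icc (S.τ 1 - ε) (S.τ 2)) 1 S.f v q ∧
            v (S.τ 1 - ε) = s.u (S.τ 1 - ε) ∧
            (∃ C : ℝ≥0∞, C < ⊤ ∧ ∀ t ∈ Icc (S.τ 1 - ε) (S.τ 2), ∫⁻ x, ‖v t x‖ₑ ^ 2 ≤ C) ∧
            (∀ t ∈ Icc (S.τ 1) (S.τ 2), ∀ x, ‖v t x‖ ≤ S.c₂ * TowerRates.wide.Y 2) ∧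
            (∃ x, ‖x‖ ≤ S.radius ∧ S.c₁ * TowerRates.wide.Y 2 ≤ ‖v (S.τ 2) x‖) ∧
            (∃ x, ‖x‖ ≤ S.radius ∧
              S.c₁ * TowerRates.wide.A 2 ≤ ‖fderiv ℝ (v (S.τ 2)) x‖) ∧
            (∃ (x : EuclideanSpace ℝ (Fin 3)) (γ : ℝ → EuclideanSpace ℝ (Fin 3)),
              ‖x‖ ≤ S.radius ∧ ContDiff ℝ 1 γ ∧ γ 0 = γ 1 ∧
              (∀ σ ∈ Icc (0 : ℝ) 1, γ σ ∈ Metric.closedBall x (1 / TowerRates.wide.N 2)) ∧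
              (∀ σ ∈ Icc (0 : ℝ) 1, ‖deriv γ σ‖ ≤ 8 * Real.pi / TowerRates.wide.N 2) ∧
              S.c₁ * TowerRates.wide.N 2 ^ (TowerRates.wide.β - 2) ≤
                circulation (v (S.τ 2)) γ)) :
    PalasekTowerBreakdown.HeredityAtOne :=
  palasekTowerBreakdown_heredityAtOne_iff_window_solutions.2 h

/-- **Item `HeredityFromTwo` (19250) in WINDOW form — no hypothesis**: heredity from level `2` on iff,
at every level `k ≥ 2`, every registered level-`k` stage of every pinned rigid quiet wide design
admits one window run on `[τ k - ε, τ (k+1)]` from its own state with the ceiling `c₂ Y_{k+1}` and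
the level-`k+1` floors (`heredityAt_iff_window_solutions` level by level). [cite: Sohr2001, Ch. V Thm. 1.5.1] -/
theorem palasekTowerBreakdown_heredityFromTwo_iff_window_solutions :
    PalasekTowerBreakdown.HeredityFromTwo ↔ ∀ k : ℕ, 2 ≤ k →
      ∀ S : Schedule TowerRates.wide, S.Pins 8 (6 / 5) → S.Rigid → S.Quiet →
        ∀ s : Stage 1 TowerRates.wide S (Margins.routeG TowerRates.wide) k,
          ∃ ε : ℝ, 0 < ε ∧ ε ≤ S.τ k ∧
          ∃ (v : ℝ → EuclideanSpace ℝ (Fin 3) → EuclideanSpace ℝ (Fin 3))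
            (q : ℝ → EuclideanSpace ℝ (Fin 3) → ℝ),
            IsClassicalNSSolutionOn (Icc (S.τ k - ε) (S.τ (k + 1))) 1 S.f v q ∧
            v (S.τ k - ε) = s.u (S.τ k - ε) ∧
            (∃ C : ℝ≥0∞, C < ⊤ ∧ ∀ t ∈ Icc (S.τ k - ε) (S.τ (k + 1)), ∫⁻ x, ‖v t x‖ₑ ^ 2 ≤ C) ∧
            (∀ t ∈ Icc (S.τ k) (S.τ (k + 1)), ∀ x, ‖v t x‖ ≤ S.c₂ * TowerRates.wide.Y (k + 1)) ∧
            (∃ x, ‖x‖ ≤ S.radius ∧ S.c₁ * TowerRates.wide.Y (k + 1) ≤ ‖v (S.τ (k + 1)) x‖) ∧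
            (∃ x, ‖x‖ ≤ S.radius ∧
              S.c₁ * TowerRates.wide.A (k + 1) ≤ ‖fderiv ℝ (v (S.τ (k + 1))) x‖) ∧
            (∃ (x : EuclideanSpace ℝ (Fin 3)) (γ : ℝ → EuclideanSpace ℝ (Fin 3)),
              ‖x‖ ≤ S.radius ∧ ContDiff ℝ 1 γ ∧ γ 0 = γ 1 ∧
              (∀ σ ∈ Icc (0 : ℝ) 1, γ σ ∈ Metric.closedBall x (1 / TowerRates.wide.N (k + 1))) ∧
              (∀ σ ∈ Icc (0 : ℝ) 1, ‖deriv γ σ‖ ≤ 8 * Real.pi / TowerRates.wide.N (k + 1)) ∧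
              S.c₁ * TowerRates.wide.N (k + 1) ^ (TowerRates.wide.β - 2) ≤
                circulation (v (S.τ (k + 1))) γ) := by
  unfold PalasekTowerBreakdown.HeredityFromTwo
  constructor
  · intro h k hk
    exact (heredityAt_iff_window_solutions k).1 (h.heredityAt hk)
  · intro h S hP hR hQ k hk s
    exact (heredityAt_iff_window_solutions k).2 (h k hk) S hP hR hQ s

/-- **The parent crux `EpisodeInduction` (19178) in WINDOW form — no hypothesis**: K2G iff, at every
level `k ≥ 1`, every registered level-`k` stage of every pinned rigid quiet wide design admits one
window run from its own state with the next ceiling and the next floors. [cite: Sohr2001, Ch. V Thm. 1.5.1] -/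
theorem palasekTowerBreakdown_episodeInduction_iff_window_solutions :
    PalasekTowerBreakdown.EpisodeInduction ↔ ∀ k : ℕ, 1 ≤ k →
      ∀ S : Schedule TowerRates.wide, S.Pins 8 (6 / 5) → S.Rigid → S.Quiet →
        ∀ s : Stage 1 TowerRates.wide S (Margins.routeG TowerRates.wide) k,
          ∃ ε : ℝ, 0 < ε ∧ ε ≤ S.τ k ∧
          ∃ (v : ℝ → EuclideanSpace ℝ (Fin 3) → EuclideanSpace ℝ (Fin 3))
            (q : ℝ → EuclideanSpace ℝ (Fin 3) → ℝ),
            IsClassicalNSSolutionOn (Icc (S.τ k - ε) (S.τ (k + 1))) 1 S.f v q ∧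
            v (S.τ k - ε) = s.u (S.τ k - ε) ∧
            (∃ C : ℝ≥0∞, C < ⊤ ∧ ∀ t ∈ Icc (S.τ k - ε) (S.τ (k + 1)), ∫⁻ x, ‖v t x‖ₑ ^ 2 ≤ C) ∧
            (∀ t ∈ Icc (S.τ k) (S.τ (k + 1)), ∀ x, ‖v t x‖ ≤ S.c₂ * TowerRates.wide.Y (k + 1)) ∧
            (∃ x, ‖x‖ ≤ S.radius ∧ S.c₁ * TowerRates.wide.Y (k + 1) ≤ ‖v (S.τ (k + 1)) x‖) ∧
            (∃ x, ‖x‖ ≤ S.radius ∧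
              S.c₁ * TowerRates.wide.A (k + 1) ≤ ‖fderiv ℝ (v (S.τ (k + 1))) x‖) ∧
            (∃ (x : EuclideanSpace ℝ (Fin 3)) (γ : ℝ → EuclideanSpace ℝ (Fin 3)),
              ‖x‖ ≤ S.radius ∧ ContDiff ℝ 1 γ ∧ γ 0 = γ 1 ∧
              (∀ σ ∈ Icc (0 : ℝ) 1, γ σ ∈ Metric.closedBall x (1 / TowerRates.wide.N (k + 1))) ∧
              (∀ σ ∈ Icc (0 : ℝ) 1, ‖deriv γ σ‖ ≤ 8 * Real.pi / TowerRates.wide.N (k + 1)) ∧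
              S.c₁ * TowerRates.wide.N (k + 1) ^ (TowerRates.wide.β - 2) ≤
                circulation (v (S.τ (k + 1))) γ) := by
  unfold PalasekTowerBreakdown.EpisodeInduction
  rw [episodeInductionG_iff_heredityFrom_one]
  constructor
  · intro h k hk
    exact (heredityAt_iff_window_solutions k).1 (h.heredityAt hk)
  · intro h S hP hR hQ k hk s
    exact (heredityAt_iff_window_solutions k).2 (h k hk) S hP hR hQ s

end Summit.NavierStokesRegularity.NavierStokesRegularity.Theorems
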